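import Summits.KontsevichZagierPeriods.KontsevichZagierPeriods.Theorems.SoloBlindModulusCatalan
import Summits.KontsevichZagierPeriods.KontsevichZagierPeriods.Theorems.SoloBlindLineMoves
import Literature.NumberTheory.Transcendental.KZDominatedFamilyRelations
import HarnessLib

/-!
# Integrating the Legendre family over its modulus inside the rules, III: `∫₀¹ E(k) dk = G + 1/2`

Part II (`SoloBlindModulusCatalan`) moved `[(0,1)², √((1-k²t²)/(1-t²)) dk dt]` ("`∫₀¹ E(k) dk`",
`legEBox`) along the modulus chart to the rational form `[(0,1)², 2(1-u²)²/(1+u²)³]`, `u = xy`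
(`eSrcBox`).  Here we finish the computation of its class INSIDE the rules:

* rule (1b): `2(1-u²)²/(1+u²)³ = 1/(1+u²) + h(u)`, `h(u) = (1 - 6u² + u⁴)/(1+u²)³`
  (`eSrcBox_sub_betaBoxRep_sub_exBox`);
* the exact part `h(xy) = ∂ₓ P(y, x)`, `P(y, x) = (x - y²x³)/(1 + y²x²)²`, so two moves of
  rule (3) (Newton–Leibniz in `x` on `[0,1]² → [0,1]`, then in `y` with primitive `y/(1+y²)`)
  take `[[0,1]², h(xy)]` to `[[0,1], (1-y²)/(1+y²)²]` and on to the point cell `[pt, 1/2]`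
  (`exBand_sub_gLine`, `gLine_sub_halfCell`); the open and the closed square differ by a null,
  hence trivial, representation (`exBand_sub_exBox`).

Consequently `[(0,1)², √((1-k²t²)/(1-t²)) dk dt] = [Bβ₂] + [pt, 1/2]` in `Q` (`mkQ_legEBox`),
`∫₀¹∫₀¹ √((1-k²t²)/(1-t²)) dt dk = ∫₀¹ E(k) dk = G + 1/2` (`legEBox_value`,
`integral_integral_ellEf_eq`), and the Kontsevich–Zagier conjecture holds for the pair of
rational representations (volume under the graph of `√((1-k²t²)/(1-t²))`, `eSrcBox`) of `G + 1/2`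
(`kz_modulus_E`).  Together with part II: `∫₀¹ (K - E) dk = G - 1/2`, `∫₀¹ (2E - K) dk = 1` are
identities between classes in `Q`, not only between numbers.

References: P. F. Byrd, M. D. Friedman, *Handbook of elliptic integrals* (1971), 615.01–615.14;
M. Kontsevich, D. Zagier, *Periods* (2001), §1.2.
-/

noncomputable section

namespace Summit.KontsevichZagierPeriods.KontsevichZagierPeriods.Theorems

open Set MeasureTheory
open Literature.ModelTheory.ExponentialFields (IsSemialgebraic isSemialgebraic_setOf_eval_nonneg
  isSemialgebraic_setOf_eval_le)
open MvPolynomial (aeval X C)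
open Literature.NumberTheory.Transcendental
open Literature.NumberTheory.Transcendental.KZ

namespace SoloBlind

/-! ## The exact part and its primitive -/

/-- `h(u) = (1 - 6u² + u⁴)/(1+u²)³`, the exact part of the pulled-back `E`-form. -/
def exactE (u : ℝ) : ℝ := (1 - 6 * u ^ 2 + u ^ 4) / (1 + u ^ 2) ^ 3

/-- `P(y, x) = (x - y²x³)/(1 + y²x²)²`, an `x`-primitive of `h(xy)`. -/
def primE (y x : ℝ) : ℝ := (x - y ^ 2 * x ^ 3) / (1 + y ^ 2 * x ^ 2) ^ 2

/-- `∂ₓ P(y, x) = h(xy)`. -/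
theorem hasDerivAt_primE (y x : ℝ) : HasDerivAt (fun s => primE y s) (exactE (y * x)) x := by
  have hD : (1 : ℝ) + y ^ 2 * x ^ 2 ≠ 0 := by positivity
  have hD' : (1 : ℝ) + (y * x) ^ 2 ≠ 0 := by positivity
  have hc := (hasDerivAt_id' x).sub ((hasDerivAt_pow 3 x).const_mul (y ^ 2))
  have hd := (((hasDerivAt_pow 2 x).const_mul (y ^ 2)).const_add 1).pow 2
  have hx : ((1 : ℝ) + y ^ 2 * x ^ 2) ^ 2 ≠ 0 := by positivity
  refine ((hc.div hd hx).congr_deriv ?_ : HasDerivAt (fun s => primE y s) _ x)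
  simp only [exactE, Nat.cast_ofNat, Pi.sub_apply, Pi.pow_apply]
  field_simp
  ring

/-- `d/dy [y/(1+y²)] = (1-y²)/(1+y²)² = P(y, 1) - P(y, 0)`. -/
theorem hasDerivAt_boundaryE (y : ℝ) :
    HasDerivAt (fun s : ℝ => s / (1 + s ^ 2)) (primE y 1 - primE y 0) y := by
  have hD : (1 : ℝ) + y ^ 2 ≠ 0 := by positivity
  have h := (hasDerivAt_id' y).div (((hasDerivAt_pow 2 y)).const_add 1) hD
  refine h.congr_deriv ?_
  simp only [primE, Nat.cast_ofNat]
  field_simp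
  ring

/-! ## The closed square and the four representations -/

/-- The closed unit square `[0,1]²`. -/
def kzClosedSquare : Set (Fin 2 → ℝ) := {z | (0 ≤ z 0 ∧ z 0 ≤ 1) ∧ 0 ≤ z 1 ∧ z 1 ≤ 1}

/-- `[0,1]²` is `ℚ`-semialgebraic. -/
theorem isSemialgebraic_kzClosedSquare : IsSemialgebraic ℚ kzClosedSquare := by
  have h0 := isSemialgebraic_setOf_eval_nonneg (R := ℝ) (X 0 : MvPolynomial (Fin 2) ℚ)
  have h1 := isSemialgebraic_setOf_eval_le (R := ℝ) (X 0 : MvPolynomial (Fin 2) ℚ) 1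
  have h2 := isSemialgebraic_setOf_eval_nonneg (R := ℝ) (X 1 : MvPolynomial (Fin 2) ℚ)
  have h3 := isSemialgebraic_setOf_eval_le (R := ℝ) (X 1 : MvPolynomial (Fin 2) ℚ) 1
  convert (h0.inter h1).inter (h2.inter h3) using 1
  all_goals first | rfl | (ext z; simp [kzClosedSquare])

/-- `(0,1)² ⊆ [0,1]²`. -/
theorem kzOpenBox_subset_kzClosedSquare : kzOpenBox 2 ⊆ kzClosedSquare := fun _ hz =>
  ⟨⟨(hz 0).1.le, (hz 0).2.le⟩, (hz 1).1.le, (hz 1).2.le⟩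

/-- `[0,1]² ∖ (0,1)²` is null (four segments). -/
theorem volume_kzClosedSquare_diff : volume (kzClosedSquare \ kzOpenBox 2) = 0 := by
  have hp : ∀ (i : Fin 2) (a : ℝ), volume {z : Fin 2 → ℝ | z i = a} = 0 := fun i a => by
    rw [MeasureTheory.volume_pi]
    exact Measure.pi_hyperplane (fun _ : Fin 2 => (volume : Measure ℝ)) i a
  refine measure_mono_null (fun z ⟨hC, hO⟩ => ?_)
    (measure_union_null (measure_union_null (hp 0 0) (hp 0 1))
      (measure_union_null (hp 1 0) (hp 1 1)))
  by_contra h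
  simp only [mem_union, mem_setOf_eq, not_or] at h
  refine hO fun i => ?_
  fin_cases i
  · exact ⟨lt_of_le_of_ne hC.1.1 (Ne.symm h.1.1), lt_of_le_of_ne hC.1.2 h.1.2⟩
  · exact ⟨lt_of_le_of_ne hC.2.1 (Ne.symm h.2.1), lt_of_le_of_ne hC.2.2 h.2.2⟩

/-- **`[[0,1]², h(xy)]`**, KZ-rational. -/
def exBand : IntegralRep 2 :=
  ratRep kzClosedSquare (fun p => exactE (p 0 * p 1))
    (1 - 6 * (X 0 * X 1) ^ 2 + (X 0 * X 1) ^ 4) ((1 + (X 0 * X 1) ^ 2) ^ 3)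
    isSemialgebraic_kzClosedSquare
    (fun p _ => by
      have : (0 : ℝ) < (1 + (p 0 * p 1) ^ 2) ^ 3 := by positivity
      simpa using this.ne')
    (fun p _ => by simp [exactE])
    (by
      have hc : Continuous fun p : Fin 2 → ℝ => exactE (p 0 * p 1) :=
        (Continuous.div (by fun_prop) (by fun_prop) fun u : ℝ =>
          (by positivity : (0 : ℝ) < (1 + u ^ 2) ^ 3).ne' : Continuous exactE).comp (by fun_prop)
      refine (hc.continuousOn.integrableOn_compact
        (isCompact_Icc (a := (0 : Fin 2 → ℝ)) (b := 1))).mono_set fun z hz => ⟨?_, ?_⟩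
      · exact Fin.forall_fin_two.2 ⟨by simpa using hz.1.1, by simpa using hz.2.1⟩
      · exact Fin.forall_fin_two.2 ⟨by simpa using hz.1.2, by simpa using hz.2.2⟩)

/-- **`[(0,1)², h(xy)]`**, the restriction of `exBand` to the open square. -/
def exBox : IntegralRep 2 :=
  exBand.restrict (kzOpenBox 2) (isSemialgebraic_kzOpenBox 2) kzOpenBox_subset_kzClosedSquare

/-- **`[[0,1], P(y,1) - P(y,0)] = [[0,1], (1-y²)/(1+y²)²]`**. -/
def gLine : IntegralRep 1 :=
  lineRep (Icc 0 1) (fun y => primE y 1 - primE y 0)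
    (isSemialgebraic_line_Icc isAlgebraic_zero isAlgebraic_one)
    ((isSemialgebraicFunOn_aeval_div_aeval (isSemialgebraic_line_Icc isAlgebraic_zero
        isAlgebraic_one) (1 - X 0 ^ 2) ((1 + X 0 ^ 2) ^ 2) fun x _ => by
          have : (0 : ℝ) < (1 + x 0 ^ 2) ^ 2 := by positivity
          simpa using this.ne').congr fun x _ => by simp [primE])
    (Continuous.integrableOn_Icc (by
      refine Continuous.sub (Continuous.div (by fun_prop) (by fun_prop) fun y => ?_)
        (Continuous.div (by fun_prop) (by fun_prop) fun y => ?_) <;> positivity))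

/-- **The point cell `[pt, 1/2]`.** -/
def halfCell : IntegralRep 0 :=
  constCell (1 / 2) (by
    have h := isAlgebraic_algebraMap (R := ℚ) (A := ℝ) ((1 : ℚ) / 2)
    rwa [map_div₀, map_one, map_ofNat] at h)

/-! ## The moves -/

/-- **Rule (1b)**: `[(0,1)², 2(1-u²)²/(1+u²)³] - [Bβ₂] - [(0,1)², h(u)]` is a relation. -/
theorem eSrcBox_sub_betaBoxRep_sub_exBox :
    of eSrcBox - of (betaBoxRep 2) - of exBox ∈ relations :=
  integrandAddRel_subset_relations ⟨2, eSrcBox, betaBoxRep 2, exBox, rfl, rfl, fun p _ => by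
    have h : (1 : ℝ) + (p 0 * p 1) ^ 2 ≠ 0 := by positivity
    simp only [eSrcBox, exBox, exBand, betaBoxRep, IntegralRep.restrict, ratRep_integrand,
      Pi.add_apply, Fin.prod_univ_two, tC, tW, exactE]
    field_simp
    ring, rfl⟩

/-- **Null modification**: `[[0,1]², h] - [(0,1)², h]` is a relation. -/
theorem exBand_sub_exBox : of exBand - of exBox ∈ relations :=
  exBand.of_sub_of_restrict_mem_relations (isSemialgebraic_kzOpenBox 2)
    kzOpenBox_subset_kzClosedSquare volume_kzClosedSquare_diff

/-- **Rule (3) in `x`**: `[[0,1]², ∂ₓP] - [[0,1], P(·,1) - P(·,0)]` is a relation. -/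
theorem exBand_sub_gLine : of exBand - of gLine ∈ relations := by
  have e0 : ∀ (x : Fin 1 → ℝ) (t : ℝ), (Fin.snoc x t : Fin 2 → ℝ) 0 = x 0 := fun _ _ => rfl
  have e1 : ∀ (x : Fin 1 → ℝ) (t : ℝ), (Fin.snoc x t : Fin 2 → ℝ) 1 = t := fun _ _ => rfl
  refine newtonLeibnizRel_subset_relations ⟨1, exBand, gLine, fun _ => 0, fun _ => 1,
    fun z => primE (z 0) (z 1), ?_,
    isSemialgebraicFunOn_const_of_isAlgebraic gLine.isSemialgebraic_domain isAlgebraic_zero,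
    isSemialgebraicFunOn_const_of_isAlgebraic gLine.isSemialgebraic_domain isAlgebraic_one,
    fun _ _ => zero_le_one, ?_, ?_, ?_, ?_, rfl⟩
  · exact (isSemialgebraicFunOn_aeval_div_aeval isSemialgebraic_kzClosedSquare
      (X 1 - X 0 ^ 2 * X 1 ^ 3) ((1 + X 0 ^ 2 * X 1 ^ 2) ^ 2) fun z _ => by
        have : (0 : ℝ) < (1 + z 0 ^ 2 * z 1 ^ 2) ^ 2 := by positivity
        simpa using this.ne').congr fun z _ => by simp [primE]
  · ext z
    simp only [exBand, ratRep_domain, kzClosedSquare, mem_setOf_eq, gLine, lineRep_domain,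
      mem_line, mem_Icc, Fin.init, Fin.castSucc_zero, show (Fin.last 1 : Fin 2) = 1 from rfl]
  · intro x _
    simp only [e0, e1]
    exact fun t _ => (hasDerivAt_primE (x 0) t).continuousAt.continuousWithinAt
  · intro x _ t _
    simp only [e0, e1, exBand, ratRep_integrand]
    exact hasDerivAt_primE (x 0) t
  · intro x _
    simp only [gLine, lineRep_integrand, e0, e1]

/-- **Rule (3) in `y`**: `[[0,1], (1-y²)/(1+y²)²] - [pt, 1/2]` is a relation
(primitive `y/(1+y²)`). -/
theorem gLine_sub_halfCell : of gLine - of halfCell ∈ relations := by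
  have hhalf : IsAlgebraic ℚ ((1 : ℝ) / 2) := by
    have h := isAlgebraic_algebraMap (R := ℚ) (A := ℝ) ((1 : ℚ) / 2)
    rwa [map_div₀, map_one, map_ofNat] at h
  have hnum : (1 : ℝ) / (1 + 1 ^ 2) - 0 / (1 + 0 ^ 2) = 1 / 2 := by norm_num
  have hα : IsAlgebraic ℚ ((1 : ℝ) / (1 + 1 ^ 2) - 0 / (1 + 0 ^ 2)) := by rwa [← hnum] at hhalf
  have h : of gLine - of (constCell ((1 : ℝ) / (1 + 1 ^ 2) - 0 / (1 + 0 ^ 2)) hα) ∈ relations :=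
    lineRep_newtonLeibniz isAlgebraic_zero isAlgebraic_one zero_le_one
      (f := fun y => primE y 1 - primE y 0) (fun s : ℝ => s / (1 + s ^ 2))
      ((isSemialgebraicFunOn_aeval_div_aeval (isSemialgebraic_line_Icc isAlgebraic_zero
          isAlgebraic_one) (X 0) (1 + X 0 ^ 2) fun x _ => by
            have : (0 : ℝ) < 1 + x 0 ^ 2 := by positivity
            simpa using this.ne').congr fun x _ => by simp)
      (Continuous.div (by fun_prop) (by fun_prop) fun s =>
        (by positivity : (0 : ℝ) < 1 + s ^ 2).ne').continuousOn
      (fun t _ => hasDerivAt_boundaryE t)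
  rwa [constCell_congr hnum (hβ := hhalf)] at h

/-! ## Classes and values -/

/-- `[(0,1)², h] = [pt, 1/2]` in `Q`. -/
theorem mkQ_exBox : mkQ (of exBox) = mkQ (of halfCell) := by
  rw [← (mkQ_eq_mkQ_iff.2 exBand_sub_exBox), mkQ_eq_mkQ_iff.2 exBand_sub_gLine]
  exact mkQ_eq_mkQ_iff.2 gLine_sub_halfCell

/-- `[(0,1)², 2(1-u²)²/(1+u²)³] = [Bβ₂] + [pt, 1/2]` in `Q`. -/
theorem mkQ_eSrcBox : mkQ (of eSrcBox) = mkQ (of (betaBoxRep 2)) + mkQ (of halfCell) := by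
  rw [← mkQ_exBox, ← map_add, mkQ_eq_mkQ_iff, ← sub_sub]
  exact eSrcBox_sub_betaBoxRep_sub_exBox

/-- **`[(0,1)², √((1-k²t²)/(1-t²)) dk dt] = [Bβ₂] + [pt, 1/2]` in `Q`.** -/
theorem mkQ_legEBox : mkQ (of legEBox) = mkQ (of (betaBoxRep 2)) + mkQ (of halfCell) := by
  rw [← mkQ_eSrcBox]
  exact (mkQ_eq_mkQ_iff.2 eSrcBox_equiv_legEBox).symm

/-- **`∫_{(0,1)²} √((1-k²t²)/(1-t²)) dk dt = G + 1/2`.** -/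
theorem legEBox_value_eq : legEBox.value = catalanConstant + 1 / 2 := by
  have h := congrArg evalQ mkQ_legEBox
  rwa [map_add, evalQ_mkQ, evalQ_mkQ, evalQ_mkQ, eval_of, eval_of, eval_of,
    betaBoxRep_value_two, halfCell, value_constCell] at h

/-- `∫_{(0,1)²} 2(1-x²y²)²/(1+x²y²)³ = G + 1/2`. -/
theorem eSrcBox_value : eSrcBox.value = catalanConstant + 1 / 2 := by
  rw [← legEBox_value, legEBox_value_eq]

/-- **`∫₀¹ E(k) dk = G + 1/2`** as an iterated integral. -/
theorem integral_integral_ellEf_eq :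
    ∫ k in Ioo (0 : ℝ) 1, ∫ t in Ioo (0 : ℝ) 1, ellEf (k ^ 2) t = catalanConstant + 1 / 2 := by
  rw [← legEBox_value_eq,
    ← setIntegral_kzOpenBox_two (fun k t => ellEf (k ^ 2) t) legEBox.integrableOn]
  rfl

/-- **`∫₀¹ (K - E) dk = G - 1/2` and `∫₀¹ (2E - K) dk = 1`, as iterated integrals.** -/
theorem integral_integral_ellKf_sub_ellEf :
    (∫ k in Ioo (0 : ℝ) 1, ∫ t in Ioo (0 : ℝ) 1, ellKf (k ^ 2) t) -
        (∫ k in Ioo (0 : ℝ) 1, ∫ t in Ioo (0 : ℝ) 1, ellEf (k ^ 2) t) = catalanConstant - 1 / 2 ∧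
      2 * (∫ k in Ioo (0 : ℝ) 1, ∫ t in Ioo (0 : ℝ) 1, ellEf (k ^ 2) t) -
        (∫ k in Ioo (0 : ℝ) 1, ∫ t in Ioo (0 : ℝ) 1, ellKf (k ^ 2) t) = 1 := by
  rw [integral_integral_ellKf_eq, integral_integral_ellEf_eq]
  constructor <;> ring

/-! ## The conjecture for this pair -/

/-- **Kontsevich–Zagier for `∫₀¹ E(k) dk = G + 1/2`.** The volume under the graph of
`√((1-k²t²)/(1-t²))` over `(0,1)²` and `[(0,1)², 2(1-x²y²)²/(1+x²y²)³]` are `ℚ`-rational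
representations of `G + 1/2` and are KZ-equivalent. -/
theorem kz_modulus_E :
    (legEBox.graphRep
        Literature.ModelTheory.ExponentialFields.tarski_seidenberg_real_holds).IsRational ∧
      eSrcBox.IsRational ∧
      (legEBox.graphRep
          Literature.ModelTheory.ExponentialFields.tarski_seidenberg_real_holds).value =
        eSrcBox.value ∧
      Equivalent (legEBox.graphRep
        Literature.ModelTheory.ExponentialFields.tarski_seidenberg_real_holds) eSrcBox :=
  ⟨IntegralRep.isRational_graphRep _ _, isRational_eSrcBox,
    by rw [← Equivalent.value_eq_holds (legEBox.equivalent_graphRep _), legEBox_value],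
    ((legEBox.equivalent_graphRep _).symm.trans eSrcBox_equiv_legEBox.symm)⟩

end SoloBlind

end Summit.KontsevichZagierPeriods.KontsevichZagierPeriods.Theorems
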